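import Mathlib.Analysis.Calculus.FDeriv.Prod
import Mathlib.LinearAlgebra.Matrix.ToLin
import Mathlib.LinearAlgebra.Determinant
import Mathlib.Topology.Algebra.Module.Determinant
import Literature.NumberTheory.Transcendental.SemialgebraicLineDeriv
import Literature.NumberTheory.Transcendental.SemialgebraicMapsProofs
import Literature.NumberTheory.Transcendental.KZCalculus

/-!
# `BetaCancellation` (stmt-KontsevichZagierPeriods-13633), line `dirichlet-companion-to-pi` — stub `stub_absDetFDeriv_semialgebraic`

**The absolute Jacobian determinant of a semialgebraic map is semialgebraic.** Let `W ⊆ ℝⁿ` be an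
OPEN `ℚ`-semialgebraic set and `ψ : ℝⁿ → ℝⁿ` a `ℚ`-semialgebraic map on `W` which is (Fréchet)
differentiable at every point of `W`. Then `w ↦ |det (fderiv ℝ ψ w)|` is a `ℚ`-semialgebraic
function on `W`.

Proof. The components `w ↦ ψ w i` are `ℚ`-semialgebraic on `W` (projection of the graph,
`isSemialgebraicMapOn_iff_forall_holds`) and differentiable on `W` (`differentiableAt_pi`), so
their partial derivatives `w ↦ fderiv ℝ (fun w => ψ w i) w eⱼ` are `ℚ`-semialgebraic on the open
set `W` (`IsSemialgebraicFunOn.fderiv_apply_single`, Basu–Pollack–Roy 2006, Prop. 3.22 and the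
remark on partial derivatives). These are exactly the entries
`LinearMap.toMatrix' (fderiv ℝ ψ w) i j = fderiv ℝ ψ w eⱼ i` of the Jacobian matrix
(`fderiv_apply`), whose determinant is `(fderiv ℝ ψ w).det` (`LinearMap.det_toMatrix'`); the
Leibniz expansion (`IsSemialgebraicFunOn.matrix_det`) and `IsSemialgebraicFunOn.abs`
(Bochnak–Coste–Roy 1998, Prop. 2.2.6) finish. No definitions; sorry-free;
axioms ⊆ {propext, Classical.choice, Quot.sound}.

References: S. Basu, R. Pollack, M.-F. Roy, *Algorithms in Real Algebraic Geometry*, 2nd ed.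
(2006), §3.5 Prop. 3.22; J. Bochnak, M. Coste, M.-F. Roy, *Real Algebraic Geometry* (1998),
Prop. 2.2.6.
-/

noncomputable section

-- `Summit.KontsevichZagierPeriods.KontsevichZagierPeriods.…` is the tree's mandated layout (single-conjunct summit).
set_option linter.dupNamespace false

namespace Summit.KontsevichZagierPeriods.KontsevichZagierPeriods.BetaCancellationLine

open Set
open Literature.NumberTheory.Transcendental
open Literature.NumberTheory.Transcendental.KZ

/-! ### Entries of the Jacobian matrix -/

/-- On an open set, every entry `(i, j)` of the Jacobian matrix
`LinearMap.toMatrix' (fderiv ℝ ψ w)` of a `ℚ`-semialgebraic map `ψ` differentiable at every point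
is a `ℚ`-semialgebraic function: it is the partial derivative `∂ⱼ ψᵢ` of the `ℚ`-semialgebraic
component `ψᵢ`. [cite: BasuPollackRoy2006, Prop. 3.22] -/
theorem absDetFDeriv_toMatrix_entry_semialgebraic {n : ℕ} {W : Set (Fin n → ℝ)} (hW : IsOpen W)
    (hWs : Literature.ModelTheory.ExponentialFields.IsSemialgebraic ℚ W)
    (ψ : (Fin n → ℝ) → (Fin n → ℝ)) (hψ : IsSemialgebraicMapOn ℚ W ψ)
    (hd : ∀ w ∈ W, DifferentiableAt ℝ ψ w) (i j : Fin n) :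
    IsSemialgebraicFunOn ℚ W fun w =>
      LinearMap.toMatrix' ((fderiv ℝ ψ w : (Fin n → ℝ) →L[ℝ] (Fin n → ℝ)) :
        (Fin n → ℝ) →ₗ[ℝ] (Fin n → ℝ)) i j := by
  have hcomp : IsSemialgebraicFunOn ℚ W fun w => ψ w i :=
    (isSemialgebraicMapOn_iff_forall_holds hWs).1 hψ i
  refine (IsSemialgebraicFunOn.fderiv_apply_single hW hcomp
    (fun w hw => differentiableAt_pi.1 (hd w hw) i) j).congr fun w hw => ?_
  show fderiv ℝ (fun w => ψ w i) w (Pi.single j 1) = _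
  rw [LinearMap.toMatrix'_apply, fderiv_apply (hd w hw) i]
  rfl

/-! ### The stub -/

/-- **Semialgebraic Jacobian** (seat c14). On an OPEN `ℚ`-semialgebraic `W ⊆ ℝⁿ`, the absolute
Jacobian determinant `w ↦ |det (fderiv ℝ ψ w)|` of a `ℚ`-semialgebraic map `ψ` differentiable at
every point of `W` is `ℚ`-semialgebraic on `W` (partial derivatives of the components are
semialgebraic, `IsSemialgebraicFunOn.fderiv_apply_single`; Leibniz expansion,
`IsSemialgebraicFunOn.matrix_det`; `LinearMap.det_toMatrix'`; `IsSemialgebraicFunOn.abs`).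
[cite: BasuPollackRoy2006, Prop. 3.22] -/
theorem stub_absDetFDeriv_semialgebraic {n : ℕ} {W : Set (Fin n → ℝ)} (hW : IsOpen W)
    (hWs : Literature.ModelTheory.ExponentialFields.IsSemialgebraic ℚ W)
    (ψ : (Fin n → ℝ) → (Fin n → ℝ)) (hψ : IsSemialgebraicMapOn ℚ W ψ)
    (hd : ∀ w ∈ W, DifferentiableAt ℝ ψ w) :
    IsSemialgebraicFunOn ℚ W fun w => |(fderiv ℝ ψ w).det| := by
  have hdet : IsSemialgebraicFunOn ℚ W fun w => (fderiv ℝ ψ w).det :=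
    (IsSemialgebraicFunOn.matrix_det hWs
      (absDetFDeriv_toMatrix_entry_semialgebraic hW hWs ψ hψ hd)).congr
      fun w _ => LinearMap.det_toMatrix' _
  exact hdet.abs

end Summit.KontsevichZagierPeriods.KontsevichZagierPeriods.BetaCancellationLine
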